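import Mathlib
import HarnessLib
import Summits.HubbardSuperconductivity.HubbardSuperconductivity.Theorems.KLProgrammeKLRegimeEngineV8DefsG12

/-!
# K3 ENGINE package, `G`-level v13 — NAME-OF-RECORD candidate for the post-FREEZE «AMENDMENT 24 — (c)-OUT» (plan g23 (R237)/(R240), 2026-08-28):
# `klEngGeo13 := (klEngGeo11.scaleGains 2).addShellLogPP (klTSA + 2^52)` (cell gate-hubbard-kl, seat hubbard-kl-k3c2-p2 g19; memo OUT-OF-CLASS-E2.md §8–§9a)

WHY.  Out of class the (E2″-F)ₙ₊₁ increment is (i) a same-shell flow step — ONE copy of the step's bars at `klEngGeo11` (`outClass_sameFrame_le_bars`) — PLUS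
(iii) the un-smearing step, typed («UNSMEAR-RESUMMED», (R240)) as class #5's relative clause for the pair `(s_{n,n+1} | 0)` at the frame `Kₙ`:
`member(n,n+1) − plain(n) = plain(n)·(N_t − 1) + (defect ≤ Tb)`.  The defect bar `Tb` books like one in-class step — a SECOND COPY of `klEngGeo11`'s bars,
whence `scaleGains 2` (WF-covariant, `…_scaleGains_of` pattern; `eremBar` untouched) — and the Neumann term `(3/2)·m²·Σ_c|tₙ[s_{n,n+1}](Qm,c)|` books, via «XS-PP-MASS»
(`sum_abs_klTransferWeight_le_shellLog`: `Σ|t| ≤ (90κ_G·klTS + 2¹⁸)(klRelGain n ρ + 2⁻ⁿ)`, `384·(90κ_G klTS + 2¹⁸) ≤ 2¹⁷klTS + 2²⁷` at `κ_G ≤ 3.4`), into a particle–particle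
shell-log addend whose coefficient must be `klTS`-SYMBOLIC (the two-shell area constant is ∃-opaque): `addShellLogPP (klTSA + 2^52)`, `klTSA = 2⁶⁰·klTS`.
* **`klEngGeo13 := (klEngGeo11.scaleGains 2).addShellLogPP (klTSA + 2^52)`**, `klEngGeo13_wf`; rfl / order rows (`phGain = 2·phGain₁₁`, `ppGain = 2·ppGain₁₁ + addend`,
  `CF = 2·CF₁₁ + 7(klTSA + 2⁵²)`, `cE4`/`S`/`SL`/`Bf`/`cloc`/`θ`/blocks/drive unchanged, so `klE4TF/klE4T6/klE4T ≤ cE4`, `klS6 ≤ S` ride);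
* THE BOOKING LINES: `gainBar_klEngGeo13_eq` (`= 2·gainBar G11 + (Klam U)²·(klTSA + 2⁵²)·(klRelGain n (ρpp⊔0) + 2⁻ⁿ)`), `two_mul_thermalBar_klEngGeo11_le_klEngGeo13`,
  `xsMass_le_gainBar_klEngGeo13` (the Neumann term's target: `(Klam U)²·(2¹⁷klTS + 2²⁷)·(klRelGain + 2⁻ⁿ) ≤` the pp addend), and
  **`three_steps_le_bars_klEngGeo13`**: `S₁ ≤ gainBar G11 + E₁ + th G11` (step (i)), `S₂ ≤ gainBar G11 + E₂ + th G11` (the defect `Tb` of (iii)),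
  `S₃ ≤ (Klam U)²·(2¹⁷klTS + 2²⁷)·(klRelGain n ρpp + 2⁻ⁿ)` (the Neumann term, `0 ≤ ρpp`) ⇒ `S₁ + S₂ + S₃ ≤ gainBar G13 + (E₁ + E₂) + thermalBar G13`;
  `eremBar_klEngGeo13_eq` (rfl), (E5-F) lift.
TEXT-NEUTRAL: no package of record moves here (the token swap `klEngGeo11 ↦ klEngGeo13` is AMENDMENT 24, gated per (R237)(b)); `klEngGeo12` (…DefsG12) is the superseded
stepping stone.  Definitions with bodies + order lemmas; nothing about the model is asserted; nothing asserts (E2″-F), (c), K3 or superconductivity.  0 kit · 0 lit.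
-/

noncomputable section

namespace Summit.HubbardSuperconductivity.HubbardSuperconductivity.Theorems.EngineV8

set_option linter.dupNamespace false -- summit = problem name (single-conjunct summit), D-0017

open Real Finset Literature.MathematicalPhysics.QuantumLattice Literature.Probability.LatticeModels
open Summit.HubbardSuperconductivity.HubbardSuperconductivity.Theorems.KLRegimeSplit
open Summit.HubbardSuperconductivity.HubbardSuperconductivity.Theorems.KLProgrammeLegKernels
open Summit.HubbardSuperconductivity.HubbardSuperconductivity.Theorems.DispersionFlow

/-! ## §1 The token candidate `klEngGeo13` -/

/-- **`klXSA := klTSA + 2⁵²`** — the coefficient of the particle–particle shell-log addend: `klTS`-symbolic room `2⁶⁰·klTS` for the two-shell numerals of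
«XS-PP-MASS» plus `2⁵²` for its single-shell numerals. -/
def klXSA : ℝ := klTSA + 2 ^ 52

/-- `klXSA = klTSA + 2⁵²` (`rfl`). -/
theorem klXSA_eq : klXSA = klTSA + 2 ^ 52 := rfl

/-- `0 ≤ klXSA`. -/
theorem klXSA_nonneg : 0 ≤ klXSA := by have := klTSA_nonneg; unfold klXSA; positivity

/-- **The room of the addend**: `2¹⁷·klTS + 2²⁷ ≤ klXSA`. -/
theorem xsNumerals_le_klXSA : 2 ^ 17 * klTS + 2 ^ 27 ≤ klXSA := by
  have h := klTS_nonneg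
  rw [klXSA_eq, klTSA_eq]
  nlinarith

/-- **`klEngGeo13` — the engine-flow package's absolute constants `G`, v13 (AMENDMENT 24 name-of-record candidate)**: TWO copies of `klEngGeo11`'s gains and freezing
constant (`scaleGains 2`) and the particle–particle shell-log addend `klXSA·(klRelGain n (ρ⊔0) + 2⁻ⁿ)`; nothing else moved. -/
def klEngGeo13 : GeoConsts := (klEngGeo11.scaleGains 2).addShellLogPP klXSA

/-- `klEngGeo13 = (klEngGeo11.scaleGains 2).addShellLogPP klXSA` (`rfl`). -/
theorem klEngGeo13_eq : klEngGeo13 = (klEngGeo11.scaleGains 2).addShellLogPP klXSA := rfl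

/-- **`klEngGeo13` is well formed.** -/
theorem klEngGeo13_wf : klEngGeo13.WF :=
  GeoConsts.addShellLogPP_wf (GeoConsts.scaleGains_wf klEngGeo11_wf (by norm_num)) klXSA_nonneg

/-- the ph gain: `klEngGeo13.phGain n ρ = 2·klEngGeo11.phGain n ρ`. -/
theorem klEngGeo13_phGain (n : ℕ) (ρ : ℝ) : klEngGeo13.phGain n ρ = 2 * klEngGeo11.phGain n ρ := rfl

/-- the pp gain: `klEngGeo13.ppGain n ρ = 2·klEngGeo11.ppGain n ρ + klXSA·(klRelGain n (ρ⊔0) + 2⁻ⁿ)`. -/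
theorem klEngGeo13_ppGain (n : ℕ) (ρ : ℝ) :
    klEngGeo13.ppGain n ρ = 2 * klEngGeo11.ppGain n ρ + klXSA * (klRelGain n (max ρ 0) + ((2 : ℝ) ^ n)⁻¹) := rfl

/-- the freezing constant: `klEngGeo13.CF = 2·klEngGeo11.CF + 7·klXSA`. -/
theorem klEngGeo13_CF : klEngGeo13.CF = 2 * klEngGeo11.CF + 7 * klXSA := rfl

/-- `2·klEngGeo11.CF ≤ klEngGeo13.CF`. -/
theorem two_mul_klEngGeo11_CF_le_klEngGeo13_CF : 2 * klEngGeo11.CF ≤ klEngGeo13.CF := by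
  rw [klEngGeo13_CF]; have := klXSA_nonneg; linarith

/-- `klEngGeo11.CF ≤ klEngGeo13.CF`. -/
theorem klEngGeo11_CF_le_klEngGeo13_CF : klEngGeo11.CF ≤ klEngGeo13.CF := by
  have := klEngGeo11_CF_nonneg; have := two_mul_klEngGeo11_CF_le_klEngGeo13_CF; linarith

/-- `0 ≤ klEngGeo13.CF`. -/
theorem klEngGeo13_CF_nonneg : 0 ≤ klEngGeo13.CF := klEngGeo11_CF_nonneg.trans klEngGeo11_CF_le_klEngGeo13_CF

/-- `klIsoT⁴ ≤ klEngGeo13.CF` (rides). -/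
theorem klIsoT_pow_four_le_klEngGeo13_CF : klIsoT ^ 4 ≤ klEngGeo13.CF := klIsoT_pow_four_le_klEngGeo11_CF.trans klEngGeo11_CF_le_klEngGeo13_CF

/-- the gains grow: ph. -/
theorem klEngGeo11_phGain_le_klEngGeo13_phGain (n : ℕ) (ρ : ℝ) : klEngGeo11.phGain n ρ ≤ klEngGeo13.phGain n ρ := by
  rw [klEngGeo13_phGain]; have := klEngGeo11_phGain_nonneg n ρ; linarith

/-- the gains grow: pp. -/
theorem klEngGeo11_ppGain_le_klEngGeo13_ppGain (n : ℕ) (ρ : ℝ) : klEngGeo11.ppGain n ρ ≤ klEngGeo13.ppGain n ρ := by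
  rw [klEngGeo13_ppGain]
  have := klEngGeo11_ppGain_nonneg n ρ
  have := klRelGain_nonneg n (le_max_right ρ 0)
  have := klXSA_nonneg
  have : 0 ≤ klXSA * (klRelGain n (max ρ 0) + ((2 : ℝ) ^ n)⁻¹) := by positivity
  linarith

/-- untouched field `cE4`. -/
theorem klEngGeo13_cE4 : klEngGeo13.cE4 = klEngGeo11.cE4 := rfl
/-- `klE4TF ≤ klEngGeo13.cE4` (rides). -/
theorem klE4TF_le_klEngGeo13_cE4 : klE4TF ≤ klEngGeo13.cE4 := klE4TF_le_klEngGeo11_cE4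
/-- `klE4T6 ≤ klEngGeo13.cE4` (rides). -/
theorem klE4T6_le_klEngGeo13_cE4 : klE4T6 ≤ klEngGeo13.cE4 := klE4T6_le_klEngGeo11_cE4
/-- `klE4T ≤ klEngGeo13.cE4` (rides). -/
theorem klE4T_le_klEngGeo13_cE4 : klE4T ≤ klEngGeo13.cE4 := klE4T_le_klEngGeo11_cE4
/-- untouched field `S`. -/
theorem klEngGeo13_S : klEngGeo13.S = klEngGeo11.S := rfl
/-- `klS6 j ≤ klEngGeo13.S j` (rides). -/
theorem klS6_le_klEngGeo13_S (j : ℕ) : klS6 j ≤ klEngGeo13.S j := klS6_le_klEngGeo11_S j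
/-- untouched field `SL`. -/
theorem klEngGeo13_SL : klEngGeo13.SL = klEngGeo11.SL := rfl
/-- untouched field `Bf`. -/
theorem klEngGeo13_Bf : klEngGeo13.Bf = klEngGeo11.Bf := rfl
/-- untouched field `bhi`. -/
theorem klEngGeo13_bhi : klEngGeo13.bhi = klEngGeo11.bhi := rfl
/-- untouched field `blo`. -/
theorem klEngGeo13_blo : klEngGeo13.blo = klEngGeo11.blo := rfl
/-- untouched field `aplus`. -/
theorem klEngGeo13_aplus : klEngGeo13.aplus = klEngGeo11.aplus := rfl
/-- untouched field `ζ`. -/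
theorem klEngGeo13_ζ : klEngGeo13.ζ = klEngGeo11.ζ := rfl
/-- untouched field `Z`. -/
theorem klEngGeo13_Z : klEngGeo13.Z = klEngGeo11.Z := rfl
/-- untouched field `cloc`. -/
theorem klEngGeo13_cloc : klEngGeo13.cloc = klEngGeo11.cloc := rfl
/-- untouched field `θ`. -/
theorem klEngGeo13_θ : klEngGeo13.θ = klEngGeo11.θ := rfl
/-- untouched field `a`. -/
theorem klEngGeo13_a : klEngGeo13.a = klEngGeo11.a := rfl
/-- untouched field `atop`. -/
theorem klEngGeo13_atop : klEngGeo13.atop = klEngGeo11.atop := rfl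
/-- untouched field `abot`. -/
theorem klEngGeo13_abot : klEngGeo13.abot = klEngGeo11.abot := rfl

/-! ## §2 The slots of (E2″-F) along `klEngGeo11 ↦ klEngGeo13` — the booking lines of AMENDMENT 24 -/

/-- `eremBar` does not read the gains or `CF`: `eremBar klEngGeo13 = eremBar klEngGeo11`. -/
theorem eremBar_klEngGeo13_eq (P : SplitConsts) (Q : EngConsts) (U β : ℝ) (L n : ℕ) :
    eremBar klEngGeo13 P Q U β L n = eremBar klEngGeo11 P Q U β L n := rfl

/-- **`gainBar` along the amendment, EXACTLY**: `gainBar klEngGeo13 = 2·gainBar klEngGeo11 + (Klam U)²·klXSA·(klRelGain n (ρpp⊔0) + 2⁻ⁿ)`. -/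
theorem gainBar_klEngGeo13_eq (P : SplitConsts) (U : ℝ) (n : ℕ) (ρpp ρd ρx : ℝ) :
    gainBar klEngGeo13 P U n ρpp ρd ρx =
      2 * gainBar klEngGeo11 P U n ρpp ρd ρx + (P.Klam * U) ^ 2 * (klXSA * (klRelGain n (max ρpp 0) + ((2 : ℝ) ^ n)⁻¹)) := by
  unfold gainBar
  rw [klEngGeo13_ppGain, klEngGeo13_phGain, klEngGeo13_phGain]
  ring

/-- `gainBar klEngGeo11 ≤ gainBar klEngGeo13`. -/
theorem gainBar_klEngGeo11_le_klEngGeo13 (P : SplitConsts) (U : ℝ) (n : ℕ) (ρpp ρd ρx : ℝ) :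
    gainBar klEngGeo11 P U n ρpp ρd ρx ≤ gainBar klEngGeo13 P U n ρpp ρd ρx := by
  rw [gainBar_klEngGeo13_eq]
  have hK : 0 ≤ (P.Klam * U) ^ 2 := sq_nonneg _
  have hg := klRelGain_nonneg n (le_max_right ρpp 0)
  have hX := klXSA_nonneg
  have h0 : 0 ≤ gainBar klEngGeo11 P U n ρpp ρd ρx := by
    unfold gainBar
    have := klEngGeo11_ppGain_nonneg n ρpp; have := klEngGeo11_phGain_nonneg n ρd; have := klEngGeo11_phGain_nonneg n ρx
    positivity
  have : 0 ≤ klXSA * (klRelGain n (max ρpp 0) + ((2 : ℝ) ^ n)⁻¹) := by positivity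
  nlinarith

/-- **`thermalBar` along the amendment**: `2·thermalBar klEngGeo11 ≤ thermalBar klEngGeo13` (the freezing constant is doubled). -/
theorem two_mul_thermalBar_klEngGeo11_le_klEngGeo13 (P : SplitConsts) (U β : ℝ) (n : ℕ) :
    2 * thermalBar klEngGeo11 P U β n ≤ thermalBar klEngGeo13 P U β n := by
  unfold thermalBar
  have := two_mul_klEngGeo11_CF_le_klEngGeo13_CF
  have : 0 ≤ (P.Klam * U) ^ 2 * ((4 : ℝ) ^ (nScales β - n))⁻¹ := by positivity
  nlinarith

/-- `thermalBar klEngGeo11 ≤ thermalBar klEngGeo13`. -/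
theorem thermalBar_klEngGeo11_le_klEngGeo13 (P : SplitConsts) (U β : ℝ) (n : ℕ) :
    thermalBar klEngGeo11 P U β n ≤ thermalBar klEngGeo13 P U β n := by
  have h := two_mul_thermalBar_klEngGeo11_le_klEngGeo13 P U β n
  have h0 : 0 ≤ thermalBar klEngGeo11 P U β n := by unfold thermalBar; have := klEngGeo11_CF_nonneg; positivity
  linarith

/-- **THE NEUMANN TERM'S TARGET**: for `0 ≤ ρpp`, `(Klam U)²·(2¹⁷·klTS + 2²⁷)·(klRelGain n ρpp + 2⁻ⁿ) ≤ gainBar klEngGeo13 − 2·gainBar klEngGeo11` (the pp shell-log addend;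
the «XS-PP-MASS» numerals `384·(90κ_G·klTS + 2¹⁸)` at `κ_G ≤ 3.4` sit inside `2¹⁷klTS + 2²⁷`). -/
theorem xsMass_le_gainBar_klEngGeo13 (P : SplitConsts) (U : ℝ) (n : ℕ) {ρpp : ℝ} (hρ : 0 ≤ ρpp) (ρd ρx : ℝ) :
    (P.Klam * U) ^ 2 * ((2 ^ 17 * klTS + 2 ^ 27) * (klRelGain n ρpp + ((2 : ℝ) ^ n)⁻¹)) ≤
      gainBar klEngGeo13 P U n ρpp ρd ρx - 2 * gainBar klEngGeo11 P U n ρpp ρd ρx := by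
  rw [gainBar_klEngGeo13_eq, add_sub_cancel_left, max_eq_left hρ]
  have hK : 0 ≤ (P.Klam * U) ^ 2 := sq_nonneg _
  have hg := klRelGain_nonneg n hρ
  have h2 : 0 ≤ ((2 : ℝ) ^ n)⁻¹ := by positivity
  have hX := xsNumerals_le_klXSA
  have : (2 ^ 17 * klTS + 2 ^ 27) * (klRelGain n ρpp + ((2 : ℝ) ^ n)⁻¹) ≤ klXSA * (klRelGain n ρpp + ((2 : ℝ) ^ n)⁻¹) :=
    mul_le_mul_of_nonneg_right hX (by positivity)
  exact mul_le_mul_of_nonneg_left this hK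

/-- **THREE TERMS FIT THE TOKEN'S BARS**: step (i) `S₁ ≤ gainBar G11 + E₁ + thermalBar G11`, the un-smearing defect `S₂ ≤ gainBar G11 + E₂ + thermalBar G11` (a second
copy), the Neumann term `S₃ ≤ (Klam U)²·(2¹⁷klTS + 2²⁷)·(klRelGain n ρpp + 2⁻ⁿ)` (`0 ≤ ρpp`) ⇒ `S₁ + S₂ + S₃ ≤ gainBar G13 + (E₁ + E₂) + thermalBar G13`. -/
theorem three_steps_le_bars_klEngGeo13 (P : SplitConsts) (U β : ℝ) (n : ℕ) {ρpp : ℝ} (hρ : 0 ≤ ρpp) (ρd ρx : ℝ) {S₁ S₂ S₃ E₁ E₂ : ℝ}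
    (h₁ : S₁ ≤ gainBar klEngGeo11 P U n ρpp ρd ρx + E₁ + thermalBar klEngGeo11 P U β n)
    (h₂ : S₂ ≤ gainBar klEngGeo11 P U n ρpp ρd ρx + E₂ + thermalBar klEngGeo11 P U β n)
    (h₃ : S₃ ≤ (P.Klam * U) ^ 2 * ((2 ^ 17 * klTS + 2 ^ 27) * (klRelGain n ρpp + ((2 : ℝ) ^ n)⁻¹))) :
    S₁ + S₂ + S₃ ≤ gainBar klEngGeo13 P U n ρpp ρd ρx + (E₁ + E₂) + thermalBar klEngGeo13 P U β n := by
  have hg := xsMass_le_gainBar_klEngGeo13 P U n hρ ρd ρx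
  have ht := two_mul_thermalBar_klEngGeo11_le_klEngGeo13 P U β n
  linarith

section Model

variable {L M : ℕ} [NeZero L] [NeZero M] {P : SplitConsts} {β U μ : ℝ} {n : ℕ}

/-- (E5-F) lifts along `klEngGeo11 ↦ klEngGeo13`. -/
theorem isoTupleL1AtV17F_klEngGeo13_of_klEngGeo11 (h : IsoTupleL1AtV17F L M klEngGeo11 P β U μ n) : IsoTupleL1AtV17F L M klEngGeo13 P β U μ n := by
  intro B hB hvals m hm Ω hΩ x₁
  refine (h B hB hvals m hm Ω hΩ x₁).trans ?_
  have := klEngGeo11_CF_le_klEngGeo13_CF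
  have hK : 0 ≤ (P.Klam * U) ^ 2 := sq_nonneg _
  nlinarith

end Model

end Summit.HubbardSuperconductivity.HubbardSuperconductivity.Theorems.EngineV8

end
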